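import Summits.BirchSwinnertonDyer.BirchSwinnertonDyer.Theorems.EisensteinPrimesAnomalousTowerTorsionFinite
import Summits.BirchSwinnertonDyer.Rank1Residual.X11b.BDPRouteLocalKernelInertia
import Summits.BirchSwinnertonDyer.Rank1Residual.X11b.BDPRouteLocalKernelAtP
import Literature.NumberTheory.GaloisRepresentations.EulerSystem
import HarnessLib

/-!
# Route `EisensteinPrimes`, crux 2 `GoodLatticeBDPValue` (stmt-BirchSwinnertonDyer-19032), line `halves`, V20 road
# brick (f), part 7: KY Lemma 1.3.5 at the good anomalous place in the `K_∞`-currency —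
# the UNRAMIFIED local kernel `ker (H¹(K_{∞,v̄}, E[p^∞]) → H¹(I_{K_{∞,v̄}}, E[p^∞]))` is FINITE

Cell `bsd-eis`, width seat `bsd-line-x1-p1-w2` gen 3 (`--supports -19032`, closes nothing). Keller–Yin arXiv:2402.12781v2
Lemma 1.3.5 (TeX L1009–1046): «`ker(res_{M_f})` is finite and cyclic», `res_{M_f} : H¹(K_w, M_f) → H¹(I_w, M_f)^{G_w/I_w}` at the
anomalous `w ∣ p`; by Shapiro, the kernel of `H¹(K_{∞,η}, E[p^∞]) → H¹(I_η, E[p^∞])` at `η ∣ w` — the amount by which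
KY's UNRAMIFIED condition at `v̄` differs from the STRICT (Greenberg/Castella) one, i.e. the local input of KY Lemma 1.3.6
(`λ(𝔛^S_Gr(f)) = λ(𝔛^S_nr(f))`) needed by the v20 «≤» road for `stub_imprimLambda` (STATUS l.3162 (R2)). With
`G = D_v̄ ⊓ ker κ` (the local tower group), `N = I_v̄ ⊓ ker κ`, `B = E_K[p^∞]^N`:
* §1 **`exists_generator_decomp_inf_kerSubgroup`** — for ANY `ℤ_p`-extension `κ` ramified at `v` (`κ(I_v) ≠ 1`) and an
  arithmetic Frobenius `φ ∈ D_v`: some `γ = φ^{p^{m₀}} τ₀ ∈ G` (`m₀` minimal, `τ₀ ∈ I_v`) generates `G` topologically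
  together with `N` (Frobenius generation `exists_eq_frobenius_pow_mul_of_mem_decompositionSubgroup`, `ℤ_p`-saturation
  of `κ(I_v)` and `κ(I_v ⊓ U₀)` from part 4, minimality of `m₀`).
* §2 **`finite_unramifiedKer_localTower`** (every `κ` with `κ(I_v̄) ≠ 1`) / **`…_of_isAnticyclotomic`** — on crux 2's
  binders `ker (H¹(G, E_K[p^∞]) → H¹(N, E_K[p^∞]))` (`subgroupResKer`) is FINITE, of order `≤ #E(K_{∞,v̄})[p^∞]`
  (part 5): `ker ↪ B/(γ−1)B` (`ResKernel.finite_subgroupResKer`), `#B/(γ−1)B ≤ #ker(γ−1|_B)` (`PrimaryCoker`),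
  `ker(γ−1|_B) = E_K[p^∞]^G`.
HONEST FRAMING: helper theorems only (0 defs, 0 named facts, 0 sorry); the Selmer-level Lemma 1.3.6 is NOT assembled
here; no summit statement / BSD / IMC2 / KY 1.4.1 (iii) is proved; 0 cells move. References: [KellerYin2024] §1.3 Lemmas
1.3.5–1.3.6; [GreenbergLNM1716] §3 Lemma 3.3; [NeukirchANT1999] I §9 (9.4); [SerreGaloisCohomology1997] I §2.6.
-/

set_option autoImplicit false
-- the route's Theorems namespace repeats the summit name by design (D-0017 nested layout)
set_option linter.dupNamespace false

noncomputable section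

open scoped Classical Pointwise

namespace Summit.BirchSwinnertonDyer.BirchSwinnertonDyer.Theorems.AnomalousLocalTorsion

open NumberField IsDedekindDomain Field WeierstrassCurve
  Literature.NumberTheory.EllipticCurves Literature.NumberTheory.EllipticCurves.GreenbergSelmer
  Literature.NumberTheory.EllipticCurves.Rank1Residual Literature.NumberTheory.GaloisRepresentations
  Summit.BirchSwinnertonDyer.BirchSwinnertonDyer.Theorems.SchneiderFreeControlAtoms
  Summit.BirchSwinnertonDyer.Rank1Residual.X11b

/-! ## §1. A topological generator of the local tower group modulo its inertia subgroup -/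

section Generator

variable {K : Type} [Field K] [NumberField K] {p : ℕ} [hp : Fact p.Prime] (κ : ZpExtension K p)

omit [NumberField K] hp in
/-- Powers in a normal-by-element situation: `(x y)^q = x^q i` with `i ∈ I` whenever `y ∈ I` and `x` normalises `I`.
[folklore] -/
theorem exists_mul_pow_eq (I : Subgroup (absoluteGaloisGroup K)) {x y : absoluteGaloisGroup K}
    (hx : ∀ i ∈ I, x⁻¹ * i * x ∈ I) (hy : y ∈ I) (q : ℕ) : ∃ i ∈ I, (x * y) ^ q = x ^ q * i := by
  induction q with
  | zero => exact ⟨1, I.one_mem, by rw [pow_zero, pow_zero, one_mul]⟩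
  | succ q ih =>
    obtain ⟨i, hi, hq⟩ := ih
    refine ⟨x⁻¹ * i * x * y, I.mul_mem (hx i hi) hy, ?_⟩
    rw [pow_succ, hq, pow_succ]
    group

/-- In an open subgroup `U₀` of the compact `Γ_K`, every element has a positive power (pigeonhole on cosets). [folklore] -/
theorem exists_pow_mem_of_isOpen (U₀ : Subgroup (absoluteGaloisGroup K)) (hU₀ : IsOpen (U₀ : Set (absoluteGaloisGroup K)))
    (g : absoluteGaloisGroup K) : ∃ k : ℕ, 0 < k ∧ g ^ k ∈ U₀ := by
  haveI : U₀.FiniteIndex := finiteIndex_of_isOpen_of_compactSpace U₀ hU₀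
  haveI : Finite (absoluteGaloisGroup K ⧸ U₀) := Subgroup.finite_quotient_of_finiteIndex
  obtain ⟨a, b, hab, h⟩ := Finite.exists_ne_map_eq_of_infinite (fun n : ℕ ↦ (QuotientGroup.mk (g ^ n) : absoluteGaloisGroup K ⧸ U₀))
  rcases Nat.lt_or_gt_of_ne hab with hlt | hlt
  · refine ⟨b - a, Nat.sub_pos_of_lt hlt, ?_⟩
    have h' := QuotientGroup.eq.mp h
    rwa [← inv_pow, show b = a + (b - a) by omega, pow_add, ← mul_assoc, inv_pow, inv_mul_cancel, one_mul] at h'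
  · refine ⟨a - b, Nat.sub_pos_of_lt hlt, ?_⟩
    have h' := QuotientGroup.eq.mp h.symm
    rwa [← inv_pow, show a = b + (a - b) by omega, pow_add, ← mul_assoc, inv_pow, inv_mul_cancel, one_mul] at h'

/-- **`ℤ_p`-saturation, divisibility form**: if `τ₁` lies in the closed subgroup `I` and `b₁ = κ τ₁ ≠ 1` has valuation
`n₁`, then every `x ∈ p^{n₁} ℤ_p` is `κ τ` for some `τ ∈ I`. [cite: Washington1997, §13.1] -/
theorem exists_mem_apply_toAdd_eq_of_dvd (I : Subgroup (absoluteGaloisGroup K)) (hI : IsClosed (I : Set (absoluteGaloisGroup K)))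
    {τ₁ : absoluteGaloisGroup K} (hτ₁ : τ₁ ∈ I) (hne : κ τ₁ ≠ 1) {x : ℤ_[p]}
    (hx : (p : ℤ_[p]) ^ ((κ τ₁).toAdd).valuation ∣ x) : ∃ τ ∈ I, (κ τ).toAdd = x := by
  set b : ℤ_[p] := (κ τ₁).toAdd with hb
  have hb0 : b ≠ 0 := fun h ↦ hne (by rw [← ofAdd_toAdd (κ τ₁), ← hb, h]; rfl)
  obtain ⟨y, hy⟩ := hx
  have hbu : b = (PadicInt.unitCoeff hb0 : ℤ_[p]) * (p : ℤ_[p]) ^ b.valuation := PadicInt.unitCoeff_spec hb0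
  obtain ⟨τ, hτI, hτ⟩ := exists_mem_apply_eq_ofAdd_mul κ I hI hτ₁ (y * (((PadicInt.unitCoeff hb0)⁻¹ : ℤ_[p]ˣ) : ℤ_[p]))
  refine ⟨τ, hτI, ?_⟩
  rw [hτ, toAdd_ofAdd, ← hb, hy]
  have h1 : y * (((PadicInt.unitCoeff hb0)⁻¹ : ℤ_[p]ˣ) : ℤ_[p]) * b =
      y * (((PadicInt.unitCoeff hb0)⁻¹ : ℤ_[p]ˣ) : ℤ_[p]) * ((PadicInt.unitCoeff hb0 : ℤ_[p]) * (p : ℤ_[p]) ^ b.valuation) := by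
    rw [← hbu]
  rw [h1, mul_assoc, ← mul_assoc (((PadicInt.unitCoeff hb0)⁻¹ : ℤ_[p]ˣ) : ℤ_[p]), Units.inv_mul, one_mul, mul_comm]

/-- **A topological generator of `D_v ⊓ ker κ` modulo `I_v ⊓ ker κ`** for a `ℤ_p`-extension `κ` RAMIFIED at `v` and an
arithmetic Frobenius `φ` at `𝔓_v`: `γ = φ^{p^{m₀}} τ₀` (`m₀` least with `φ^{pᵐ} τ ∈ ker κ` for some `τ ∈ I_v`); every
`d ∈ D_v ⊓ ker κ` is `φⁿ i u`, `κ` forces `p^{m₀} ∣ n`, and `u` is corrected by an inertia element of the same `κ`-value.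
[cite: NeukirchANT1999, I §9 Prop. (9.4)] [cite: KellerYin2024, §1.3 Lemma 1.3.5 (arXiv:2402.12781v2 TeX L1019–1021)] -/
theorem exists_generator_decomp_inf_kerSubgroup {v : HeightOneSpectrum (𝓞 K)} {φ : absoluteGaloisGroup K}
    (hφ : IsArithFrobAt (𝓞 K) φ (adicCompletionPrime K v)) (hram : ∃ τ ∈ GreenbergSelmer.inertia v, κ τ ≠ 1) :
    ∃ γ : ↥(GreenbergSelmer.decomp v ⊓ κ.kerSubgroup),
      ∀ U : Subgroup ↥(GreenbergSelmer.decomp v ⊓ κ.kerSubgroup),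
        IsOpen (U : Set ↥(GreenbergSelmer.decomp v ⊓ κ.kerSubgroup)) →
          (GreenbergSelmer.inertia v).subgroupOf (GreenbergSelmer.decomp v ⊓ κ.kerSubgroup) ≤ U → γ ∈ U → U = ⊤ := by
  have hpr : p.Prime := hp.out
  set D := GreenbergSelmer.decomp (K := K) v with hDdef
  set I := GreenbergSelmer.inertia (K := K) v with hIdef
  set G := D ⊓ κ.kerSubgroup with hGdef
  have h𝔓 := adicCompletionPrime_mem_primesAbove K v
  have hIeq : I = (adicCompletionPrime K v).inertia (absoluteGaloisGroup K) :=
    (inertia_adicCompletionPrime_eq_map_absInertia K v).symm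
  have hDeq : D = (adicCompletionPrime K v).decompositionSubgroup (absoluteGaloisGroup K) :=
    AcSelmer.decomp_eq_decompositionSubgroup_adicCompletionPrime v
  have hID : I ≤ D := GreenbergSelmer.inertia_le_decomp v
  have hIcl : IsClosed (I : Set (absoluteGaloisGroup K)) := isClosed_inertia' v
  have hφD : φ ∈ D := mem_decomp_of_isArithFrobAt hφ
  have hconjI : ∀ {x}, x ∈ D → ∀ i ∈ I, x⁻¹ * i * x ∈ I := by
    intro x hx i hi
    rw [hIeq] at hi ⊢
    exact AcSelmer.conj_mem_inertia_of_mem_decomp (v := v) hx hi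
  obtain ⟨τ₁, hτ₁, hτ₁ne⟩ := hram
  -- the minimal exponent `m₀` and `γ = φ^{p^{m₀}} τ₀`
  have hex : ∃ m : ℕ, ∃ τ ∈ I, φ ^ p ^ m * τ ∈ κ.kerSubgroup := exists_pow_mul_mem_kerSubgroup κ I hIcl hτ₁ hτ₁ne φ
  set m₀ := Nat.find hex with hm₀
  obtain ⟨τ₀, hτ₀I, hγker⟩ := Nat.find_spec hex
  have hmin : ∀ j < m₀, ∀ τ ∈ I, φ ^ p ^ j * τ ∉ κ.kerSubgroup := fun j hj τ hτ h ↦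
    Nat.find_min hex hj ⟨τ, hτ, h⟩
  have hγG : φ ^ p ^ m₀ * τ₀ ∈ G := Subgroup.mem_inf.mpr ⟨D.mul_mem (D.pow_mem hφD _) (hID hτ₀I), hγker⟩
  refine ⟨⟨φ ^ p ^ m₀ * τ₀, hγG⟩, fun U hU hNU hγU ↦ ?_⟩
  -- an open subgroup `U₀` of `Γ_K` with `G ∩ U₀ ⊆ U`
  obtain ⟨t, ht, htU⟩ := isOpen_induced_iff.mp hU
  have h1t : (1 : absoluteGaloisGroup K) ∈ t := by
    have h1 : (1 : G) ∈ Subtype.val ⁻¹' t := by rw [htU]; exact U.one_mem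
    exact h1
  obtain ⟨F, hFfin, hFt⟩ := (krullTopology_mem_nhds_one_iff K (AlgebraicClosure K) t).mp (ht.mem_nhds h1t)
  haveI := hFfin
  set U₀ : Subgroup (absoluteGaloisGroup K) := F.fixingSubgroup with hU₀
  have hU₀open : IsOpen (U₀ : Set (absoluteGaloisGroup K)) := IntermediateField.fixingSubgroup_isOpen F
  have hU₀U : ∀ g (hg : g ∈ G), g ∈ U₀ → (⟨g, hg⟩ : G) ∈ U := by
    intro g hg hgU₀
    have h : (⟨g, hg⟩ : G) ∈ Subtype.val ⁻¹' t := hFt hgU₀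
    rw [htU] at h
    exact h
  -- an inertia element `τ₂ ∈ I ∩ U₀` with `κ τ₂ ≠ 1`
  obtain ⟨k, hk, hτ₂U₀⟩ := exists_pow_mem_of_isOpen U₀ hU₀open τ₁
  set τ₂ := τ₁ ^ k with hτ₂
  have hτ₂I : τ₂ ∈ I ⊓ U₀ := Subgroup.mem_inf.mpr ⟨I.pow_mem hτ₁ k, hτ₂U₀⟩
  have hτ₂ne : κ τ₂ ≠ 1 := by
    intro h
    apply hτ₁ne
    have h' : k • (κ τ₁).toAdd = 0 := by
      have := congrArg Multiplicative.toAdd h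
      rwa [hτ₂, map_pow, toAdd_pow, toAdd_one] at this
    rw [nsmul_eq_mul, mul_eq_zero] at h'
    rcases h' with h' | h'
    · exact absurd h' (Nat.cast_ne_zero.mpr hk.ne')
    · rw [← ofAdd_toAdd (κ τ₁), h']; rfl
  have hIU₀cl : IsClosed ((I ⊓ U₀ : Subgroup (absoluteGaloisGroup K)) : Set (absoluteGaloisGroup K)) := by
    rw [Subgroup.coe_inf]; exact hIcl.inter (U₀.isClosed_of_isOpen hU₀open)
  set n₂ : ℕ := ((κ τ₂).toAdd).valuation with hn₂
  -- Frobenius generation with the open subgroup `U₁ = U₀ ⊓ κ⁻¹(p^{n₂} ℤ_p)`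
  set U₁ : Subgroup (absoluteGaloisGroup K) := U₀ ⊓ κ.layerSubgroup n₂ with hU₁
  have hU₁open : IsOpen (U₁ : Set (absoluteGaloisGroup K)) := by
    rw [hU₁, Subgroup.coe_inf]; exact hU₀open.inter (κ.isOpen_layerSubgroup n₂)
  rw [eq_top_iff]
  rintro ⟨d, hd⟩ -
  obtain ⟨hdD, hdk⟩ := Subgroup.mem_inf.mp hd
  have hdD' : d ∈ (adicCompletionPrime K v).decompositionSubgroup (absoluteGaloisGroup K) := hDeq ▸ hdD
  obtain ⟨n, i, u, hi, hu, hdeq⟩ := exists_eq_frobenius_pow_mul_of_mem_decompositionSubgroup h𝔓 hφ hU₁open hdD'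
  rw [← hIeq] at hi
  obtain ⟨huU₀, hulayer⟩ := Subgroup.mem_inf.mp hu
  -- `u ∈ D`
  have huD : u ∈ D := by
    have e : u = (φ ^ n * i)⁻¹ * d := by rw [hdeq, inv_mul_cancel_left]
    rw [e]; exact D.mul_mem (D.inv_mem (D.mul_mem (D.pow_mem hφD n) (hID hi))) hdD
  -- an inertia element `i₃ ∈ I ∩ U₀` with `κ i₃ = κ u`
  obtain ⟨i₃, hi₃, hκi₃⟩ := exists_mem_apply_toAdd_eq_of_dvd κ (I ⊓ U₀) hIU₀cl hτ₂I hτ₂ne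
    (ZpExtension.mem_layerSubgroup.mp hulayer)
  obtain ⟨hi₃I, hi₃U₀⟩ := Subgroup.mem_inf.mp hi₃
  have hκi₃' : κ i₃ = κ u := Multiplicative.toAdd.injective hκi₃
  -- division `n = p^{m₀} q + r` and `φ^{p^{m₀}} = γ τ₀⁻¹`
  set q := n / p ^ m₀ with hq
  set r := n % p ^ m₀ with hr
  have hnqr : n = p ^ m₀ * q + r := (Nat.div_add_mod n (p ^ m₀)).symm
  have hrlt : r < p ^ m₀ := Nat.mod_lt _ (pow_pos hpr.pos _)
  obtain ⟨i₁, hi₁, hpow⟩ := exists_mul_pow_eq I (x := φ ^ p ^ m₀ * τ₀) (y := τ₀⁻¹)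
    (fun j hj ↦ hconjI (D.mul_mem (D.pow_mem hφD _) (hID hτ₀I)) j hj) (I.inv_mem hτ₀I) q
  have hpow' : (φ ^ p ^ m₀) ^ q = (φ ^ p ^ m₀ * τ₀) ^ q * i₁ := by rwa [mul_inv_cancel_right] at hpow
  have hφq : φ ^ (p ^ m₀ * q) = (φ ^ p ^ m₀ * τ₀) ^ q * i₁ := by
    rw [pow_mul, hpow']
  -- additive bookkeeping for `κ`
  have hγ1 : κ (φ ^ p ^ m₀ * τ₀) = 1 := ZpExtension.mem_kerSubgroup.mp hγker
  have hA : ∀ x y : absoluteGaloisGroup K, (κ (x * y)).toAdd = (κ x).toAdd + (κ y).toAdd := fun x y ↦ by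
    rw [map_mul, toAdd_mul]
  have hAinv : ∀ x : absoluteGaloisGroup K, (κ x⁻¹).toAdd = -(κ x).toAdd := fun x ↦ by rw [map_inv, toAdd_inv]
  have hApow : ∀ (x : absoluteGaloisGroup K) (n : ℕ), (κ (x ^ n)).toAdd = (n : ℤ_[p]) * (κ x).toAdd := fun x n ↦ by
    rw [map_pow, toAdd_pow, nsmul_eq_mul]
  have hAγq : (κ ((φ ^ p ^ m₀ * τ₀) ^ q)).toAdd = 0 := by rw [map_pow, hγ1, one_pow, toAdd_one]
  have hAd : (κ d).toAdd = 0 := by rw [ZpExtension.mem_kerSubgroup.mp hdk, toAdd_one]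
  have hAu : (κ u).toAdd = (κ i₃).toAdd := by rw [hκi₃]
  -- `φ^r · ι ∈ ker κ` with `ι ∈ I`, hence `r = 0` by minimality of `m₀`
  -- the master relation: `0 = A i₁ + r·A φ + A i + A i₃`
  have hrel : (0 : ℤ_[p]) = (κ i₁).toAdd + (r : ℤ_[p]) * (κ φ).toAdd + (κ i).toAdd + (κ i₃).toAdd := by
    have h := hAd
    rw [hdeq, hnqr, pow_add, hφq, hA, hA, hA, hA, hAγq, hApow, hAu] at h
    linear_combination -h
  have hr0 : r = 0 := by
    by_contra hr0
    -- `κ(φ^r · (i i₃ i₁)) = 1`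
    have hk1 : (κ (φ ^ r * (i * i₃ * i₁))).toAdd = 0 := by
      rw [hA, hA, hA, hApow]
      linear_combination -hrel
    -- `r = p^j r'`, `p ∤ r'`, `j < m₀`
    obtain ⟨j, r', hr', hrj⟩ := Nat.exists_eq_pow_mul_and_not_dvd hr0 p hpr.ne_one
    have hjlt : j < m₀ := by
      by_contra hjm
      push Not at hjm
      have h1 : p ^ m₀ ∣ r := by rw [hrj]; exact Dvd.dvd.mul_right (pow_dvd_pow p hjm) r'
      exact absurd (Nat.le_of_dvd (Nat.pos_of_ne_zero hr0) h1) (not_le.mpr hrlt)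
    -- `κ(φ)^{p^j} ∈ κ(I)`: saturate the element `ι⁻¹ ∈ I`, `κ(ι⁻¹) = κ(φ^r)`, by the unit `r'⁻¹`
    set ι : absoluteGaloisGroup K := i * i₃ * i₁ with hι
    have hιI : ι ∈ I := I.mul_mem (I.mul_mem hi hi₃I) hi₁
    have hκι : (κ ι⁻¹).toAdd = (r : ℤ_[p]) * (κ φ).toAdd := by
      rw [hA, hApow] at hk1
      rw [hAinv]
      linear_combination -hk1
    have hr'u : IsUnit (r' : ℤ_[p]) := by
      rw [PadicInt.isUnit_iff]
      refine le_antisymm (PadicInt.norm_le_one _) (not_lt.mp fun hlt ↦ hr' ?_)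
      have h := (PadicInt.norm_int_lt_one_iff_dvd (r' : ℤ)).mp (by exact_mod_cast hlt)
      exact_mod_cast h
    obtain ⟨w, hw⟩ := hr'u
    obtain ⟨τ', hτ'I, hτ'⟩ := exists_mem_apply_eq_ofAdd_mul κ I hIcl (I.inv_mem hιI) ((w⁻¹ : ℤ_[p]ˣ) : ℤ_[p])
    have hκτ' : κ τ' = κ (φ ^ p ^ j) := by
      apply Multiplicative.toAdd.injective
      rw [hτ', toAdd_ofAdd, hκι, hApow, hrj, Nat.cast_mul, Nat.cast_pow, ← hw]
      rw [show ((p : ℤ_[p]) ^ j * (w : ℤ_[p])) * (κ φ).toAdd = (w : ℤ_[p]) * ((p : ℤ_[p]) ^ j * (κ φ).toAdd) by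
        ring, ← mul_assoc, Units.inv_mul, one_mul]
    refine hmin j hjlt τ'⁻¹ (I.inv_mem hτ'I) ?_
    rw [ZpExtension.mem_kerSubgroup, map_mul, map_inv, hκτ', mul_inv_cancel]
  -- assemble: `d = γ^q · (i₁ i i₃) · (i₃⁻¹ u)`
  have hn0 : n = p ^ m₀ * q := by rw [hnqr, hr0, add_zero]
  have hdeq' : d = (φ ^ p ^ m₀ * τ₀) ^ q * (i₁ * i * i₃) * (i₃⁻¹ * u) := by
    rw [hdeq, hn0, hφq]; group
  have hN : i₁ * i * i₃ ∈ G := by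
    refine Subgroup.mem_inf.mpr ⟨hID (I.mul_mem (I.mul_mem hi₁ hi) hi₃I), ?_⟩
    rw [ZpExtension.mem_kerSubgroup]
    apply Multiplicative.toAdd.injective
    rw [hA, hA, toAdd_one]
    rw [hr0, Nat.cast_zero, zero_mul] at hrel
    linear_combination -hrel
  have hW : i₃⁻¹ * u ∈ G := by
    refine Subgroup.mem_inf.mpr ⟨D.mul_mem (D.inv_mem (hID hi₃I)) huD, ?_⟩
    rw [ZpExtension.mem_kerSubgroup, map_mul, map_inv, hκi₃', inv_mul_cancel]
  have hNU : (⟨i₁ * i * i₃, hN⟩ : G) ∈ U := hNU (Subgroup.mem_subgroupOf.mpr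
    (I.mul_mem (I.mul_mem hi₁ hi) hi₃I))
  have hWU : (⟨i₃⁻¹ * u, hW⟩ : G) ∈ U := hU₀U _ hW (U₀.mul_mem (U₀.inv_mem hi₃U₀) huU₀)
  have e : (⟨d, hd⟩ : G) = ⟨φ ^ p ^ m₀ * τ₀, hγG⟩ ^ q * ⟨i₁ * i * i₃, hN⟩ * ⟨i₃⁻¹ * u, hW⟩ :=
    Subtype.ext (by simp only [Subgroup.coe_mul, SubgroupClass.coe_pow]; exact hdeq')
  rw [e]
  exact U.mul_mem (U.mul_mem (U.pow_mem hγU q) hNU) hWU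

end Generator

/-! ## §2. The unramified local kernel at the anomalous place is finite -/

section Kernel

variable (W : WeierstrassCurve ℚ) [W.IsElliptic] [W.IsGloballyMinimal] {p : ℕ} [hp : Fact p.Prime]
  {K : Type} [Field K] [NumberField K] (κ : ZpExtension K p)

/-- **KY Lemma 1.3.5 at the good anomalous place, `K_∞`-currency: the unramified local kernel is FINITE.** On crux 2's
binders and for every `ℤ_p`-extension `κ` with `κ(I_v̄) ≠ 1`, `G = D_v̄ ⊓ ker κ`, `N = I_v̄ ⊓ G`: the kernel of
`H¹(G, E_K[p^∞]) → H¹(N, E_K[p^∞])` (`subgroupResKer`, `H¹_ur(K_{∞,v̄}, E[p^∞])`) is finite, of order `≤ #E(K_{∞,v̄})[p^∞]`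
(Fin_v, part 5): `ker ↪ B/(γ−1)B` (`ResKernel.finite_subgroupResKer`), `#B/(γ−1)B ≤ #ker(γ−1|_B) ≤ #E_K[p^∞]^G`.
[cite: KellerYin2024, §1.3 Lemma 1.3.5 (arXiv:2402.12781v2 TeX L1009–1046)] [cite: GreenbergLNM1716, §3 Lemma 3.3 (proof, p. 87)] -/
theorem finite_unramifiedKer_localTower (hp2 : p ≠ 2) (hanom : Anom W p)
    (hGL : ∀ Φ : AddSubgroup (geomTorsion W (p : ℤ)), IsRationalLine W p Φ → ¬ LineUnramifiedAt W p Φ)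
    (hK : IsImaginaryQuadratic K) {v vbar : HeightOneSpectrum (𝓞 K)} (hpv : ((p : ℕ) : 𝓞 K) ∈ v.asIdeal)
    (hpvbar : ((p : ℕ) : 𝓞 K) ∈ vbar.asIdeal) (hne : vbar ≠ v)
    (hram : ∃ τ ∈ GreenbergSelmer.inertia vbar, κ τ ≠ 1) :
    Finite (subgroupResKer ((W.baseChange K).geomPrimaryTorsion p)
        ((GreenbergSelmer.inertia vbar).subgroupOf (GreenbergSelmer.decomp vbar ⊓ κ.kerSubgroup))) ∧
      Nat.card (subgroupResKer ((W.baseChange K).geomPrimaryTorsion p)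
        ((GreenbergSelmer.inertia vbar).subgroupOf (GreenbergSelmer.decomp vbar ⊓ κ.kerSubgroup))) ≤
        Nat.card (FixedPoints.addSubgroup ↥(GreenbergSelmer.decomp vbar ⊓ κ.kerSubgroup)
          ((W.baseChange K).geomPrimaryTorsion p)) := by
  have hpr : p.Prime := hp.out
  set M := (W.baseChange K).geomPrimaryTorsion p with hMdef
  set G : Subgroup (absoluteGaloisGroup K) := GreenbergSelmer.decomp vbar ⊓ κ.kerSubgroup with hGdef
  set N : Subgroup G := (GreenbergSelmer.inertia vbar).subgroupOf G with hNdef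
  have hIeq : GreenbergSelmer.inertia vbar = (adicCompletionPrime K vbar).inertia (absoluteGaloisGroup K) :=
    (inertia_adicCompletionPrime_eq_map_absInertia K vbar).symm
  -- `N ⊴ G`
  haveI hNn : N.Normal := by
    refine ⟨fun n hn g ↦ ?_⟩
    rw [hNdef, Subgroup.mem_subgroupOf] at hn ⊢
    rw [hIeq] at hn ⊢
    have h := AcSelmer.conj_mem_inertia_of_mem_decomp (v := vbar) (Subgroup.mem_inf.mp (g⁻¹).2).1 hn
    simpa only [Subgroup.coe_mul, Subgroup.coe_inv, inv_inv] using h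
  -- Frobenius and the generator
  obtain ⟨σK, hσK⟩ := HeightOneSpectrum.exists_isArithFrobAt_of_mem_primesAbove_holds (K := K) (v := vbar)
    (adicCompletionPrime_mem_primesAbove K vbar)
  obtain ⟨γ, hgen⟩ := exists_generator_decomp_inf_kerSubgroup κ hσK hram
  have hcont : ∀ m : M, Continuous fun g : G ↦ g • m := fun m ↦
    ((W.baseChange K).continuous_smul_geomPrimaryTorsion p m).comp continuous_subtype_val
  -- Fin_v: `M^G` is finite
  have hfinG : (FixedPoints.addSubgroup G M : Set M).Finite :=
    localTowerTorsionFiniteAt_of_exists_inertia_apply_ne_one W hp2 hanom hGL hK hpv hpvbar hne κ hram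
  haveI : Finite (FixedPoints.addSubgroup G M) := hfinG.to_subtype
  -- `ker(γ − 1 | M^N) ↪ M^G`
  have hkerfix : ∀ b : FixedPoints.addSubgroup N M, ResKernel.subOne N M γ b = 0 → ∀ g : G, g • (b : M) = b := by
    intro b hb
    have hγb : γ • (b : M) = b := by
      have h := congrArg (fun z : FixedPoints.addSubgroup N M ↦ (z : M)) hb
      simp only [ResKernel.coe_subOne_apply, ZeroMemClass.coe_zero] at h
      exact sub_eq_zero.mp h
    -- the stabiliser of `b` in `G` is an open subgroup containing `N` and `γ`
    set S : Subgroup G := MulAction.stabilizer G (b : M) with hS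
    have hSopen : IsOpen (S : Set G) := by
      have h : (S : Set G) = (fun g : G ↦ g • (b : M)) ⁻¹' {(b : M)} := by
        ext g; simp [hS, MulAction.mem_stabilizer_iff]
      rw [h]
      exact (isOpen_discrete _).preimage (hcont _)
    have hNS : N ≤ S := fun n hn ↦ MulAction.mem_stabilizer_iff.mpr (b.2 ⟨n, hn⟩)
    have hγS : γ ∈ S := MulAction.mem_stabilizer_iff.mpr hγb
    have htop := hgen S hSopen hNS hγS
    intro g
    have hg : g ∈ S := by rw [htop]; exact Subgroup.mem_top g
    exact MulAction.mem_stabilizer_iff.mp hg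
  haveI hkfin : Finite (ResKernel.subOne N M γ).ker := by
    refine Finite.of_injective (fun b : (ResKernel.subOne N M γ).ker ↦
      (⟨((b : FixedPoints.addSubgroup N M) : M), (FixedPoints.mem_addSubgroup _ _ _).mpr
        (hkerfix _ ((AddMonoidHom.mem_ker).mp b.2))⟩ : FixedPoints.addSubgroup G M)) ?_
    intro a b h
    apply Subtype.ext; apply Subtype.ext
    exact congrArg (fun z : FixedPoints.addSubgroup G M ↦ (z : M)) h
  have hkle : Nat.card (ResKernel.subOne N M γ).ker ≤ Nat.card (FixedPoints.addSubgroup G M) := by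
    refine Nat.card_le_card_of_injective (fun b : (ResKernel.subOne N M γ).ker ↦
      (⟨((b : FixedPoints.addSubgroup N M) : M), (FixedPoints.mem_addSubgroup _ _ _).mpr
        (hkerfix _ ((AddMonoidHom.mem_ker).mp b.2))⟩ : FixedPoints.addSubgroup G M)) ?_
    intro a b h
    apply Subtype.ext; apply Subtype.ext
    exact congrArg (fun z : FixedPoints.addSubgroup G M ↦ (z : M)) h
  -- `#(M^N/(γ−1)) ≤ #ker(γ−1)`
  have hprim : ∀ b : FixedPoints.addSubgroup N M, ∃ n : ℕ, p ^ n • b = 0 := fun b ↦ by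
    obtain ⟨k, hk⟩ := ((b : M)).2
    exact ⟨k, Subtype.ext (Subtype.ext (by
      rw [AddSubmonoidClass.coe_nsmul, AddSubmonoidClass.coe_nsmul, hk]; rfl))⟩
  have hlayer : ∀ n : ℕ, Finite (nsmulAddMonoidHom (p ^ n) :
      FixedPoints.addSubgroup N M →+ FixedPoints.addSubgroup N M).ker := by
    intro n
    have hfinM := AcSelmer.finite_setOf_geomPrimaryTorsion_pow_smul_eq_zero (W.baseChange K) hpr.ne_zero n
    haveI : Finite {m : M | p ^ n • m = 0} := hfinM.to_subtype
    refine Finite.of_injective (fun b : (nsmulAddMonoidHom (p ^ n) :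
        FixedPoints.addSubgroup N M →+ FixedPoints.addSubgroup N M).ker ↦
      (⟨((b : FixedPoints.addSubgroup N M) : M), ?_⟩ : {m : M | p ^ n • m = 0})) ?_
    · have hb := (AddMonoidHom.mem_ker).mp b.2
      rw [nsmulAddMonoidHom_apply] at hb
      exact congrArg (fun z : FixedPoints.addSubgroup N M ↦ (z : M)) hb
    · intro a b h
      apply Subtype.ext; apply Subtype.ext
      exact congrArg (fun z : {m : M | p ^ n • m = 0} ↦ (z : M)) h
  obtain ⟨hqfin, hqle⟩ := PrimaryCoker.natCard_quotient_range_le_natCard_ker p (ResKernel.subOne N M γ) hprim hlayer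
  haveI := hqfin
  obtain ⟨hfin, hle⟩ := ResKernel.finite_subgroupResKer N M γ hgen hcont
  exact ⟨hfin, hle.trans (hqle.trans hkle)⟩

/-- **KY Lemma 1.3.5 on the ANTICYCLOTOMIC tower**: `H¹_ur(K^{ac}_{∞,v̄}, E[p^∞])` is finite, of order at most
`#E(K^{ac}_{∞,v̄})[p^∞]`, at a good anomalous `p` on the binders of crux 2.
[cite: KellerYin2024, §1.3 Lemma 1.3.5 (arXiv:2402.12781v2 TeX L1009–1046)] [cite: Brink2007, Cor. 1] -/
theorem finite_unramifiedKer_localTower_of_isAnticyclotomic (hp2 : p ≠ 2) (hanom : Anom W p)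
    (hGL : ∀ Φ : AddSubgroup (geomTorsion W (p : ℤ)), IsRationalLine W p Φ → ¬ LineUnramifiedAt W p Φ)
    (hK : IsImaginaryQuadratic K) {v vbar : HeightOneSpectrum (𝓞 K)} (hpv : ((p : ℕ) : 𝓞 K) ∈ v.asIdeal)
    (hpvbar : ((p : ℕ) : 𝓞 K) ∈ vbar.asIdeal) (hne : vbar ≠ v) (hκ : κ.IsAnticyclotomic) :
    Finite (subgroupResKer ((W.baseChange K).geomPrimaryTorsion p)
        ((GreenbergSelmer.inertia vbar).subgroupOf (GreenbergSelmer.decomp vbar ⊓ κ.kerSubgroup))) ∧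
      Nat.card (subgroupResKer ((W.baseChange K).geomPrimaryTorsion p)
        ((GreenbergSelmer.inertia vbar).subgroupOf (GreenbergSelmer.decomp vbar ⊓ κ.kerSubgroup))) ≤
        Nat.card (FixedPoints.addSubgroup ↥(GreenbergSelmer.decomp vbar ⊓ κ.kerSubgroup)
          ((W.baseChange K).geomPrimaryTorsion p)) := by
  obtain ⟨τ, hτ, hτne⟩ := ZpExtension.exists_mem_inertia_apply_ne_one_of_isAnticyclotomic hK hp2 κ hκ hpvbar
    (adicCompletionPrime_mem_primesAbove K vbar)
  refine finite_unramifiedKer_localTower W κ hp2 hanom hGL hK hpv hpvbar hne ⟨τ, ?_, hτne⟩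
  have e : GreenbergSelmer.inertia vbar = (adicCompletionPrime K vbar).inertia (absoluteGaloisGroup K) :=
    (inertia_adicCompletionPrime_eq_map_absInertia K vbar).symm
  rw [e]
  exact hτ

end Kernel

end Summit.BirchSwinnertonDyer.BirchSwinnertonDyer.Theorems.AnomalousLocalTorsion
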